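import Summits.CriticalPhenomena.PercolationContinuityZ3.Theorems.PercAnnulusCrossingIICTargetLevelJunk
import Summits.CriticalPhenomena.PercolationContinuityZ3.Theorems.PercAnnulusCrossingIICLevelTwoSided
import HarnessLib

/-!
# Kesten–Basu–Sapozhnikov IIC scheme in boxes with a GENERAL CONDITIONING TARGET, VII″: the two-sided one-level decomposition (lane RSW3, p1 gen 4)

builds on p205010 (kernel theorem, internal audit signed; external expert review pending)

Seat `prim-rsw3-p1` (gen 4).  Part VII/VII′ with the arm event replaced by `CONN(H,X;W,T) = {∃ x ∈ X, ∃ t ∈ T, x ↔ t in W ∖ H}`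
(finite `W ⊇ Λ(τ m₂)`, `T ⊆ W ∖ Λ(τ m₂)`; Basu–Sapozhnikov Remark 2.1), general aspect `σ, τ`.  Helper file; no definitions, no sorries.
* `real_inter_conn_diff_good_le_target` — `P(E ∩ CONN ∖ GOOD) ≤ P(CONN ∩ NONUNIQ(a,b))`;
* **`sum_real_level_two_sided_target`** — `P(E ∩ CONN) − ϰ⁻² α(σ m₁, σ m₂) P(CONN) ≤ Σ_{(U,R)} P(E ∩ DAT ∩ LINK' ∩ LEFT) · P(CONN(U,R;W,T)) ≤ P(E ∩ CONN)`.
References: D. Basu, A. Sapozhnikov, ECP 22 (2017) no. 26, §2 (2.5)–(2.6) and Remark 2.1.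
-/

noncomputable section

namespace Summit.CriticalPhenomena.PercolationContinuityZ3.Theorems.Crossing

open MeasureTheory Literature.Probability.Percolation Literature.Probability.LatticeModels
open Literature.Probability.Percolation.DCT16
open Summit.CriticalPhenomena.PercolationContinuityZ3.Theorems.SurfaceTension
open scoped Literature.Probability.Percolation

variable {d : ℕ}

/-- **Outside `NONUNIQ` every configuration is `GOOD`** (general target): `P(E ∩ CONN(H,X;W,T) ∖ GOOD) ≤ P(CONN(H,X;W,T) ∩ NONUNIQ(a,b))`
for `1 ≤ a ≤ b − 1`.
[cite: BasuSapozhnikov2017ECP, §2 eq. (2.5)] -/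
theorem real_inter_conn_diff_good_le_target (p : unitInterval) {a b : ℕ} (ha : 1 ≤ a) (hab : a ≤ b - 1)
    (W T H X : Finset (Site d)) (E : Set (BondConfig (Site d))) :
    (bondPercolation (zdGraph d) p).real ((E ∩
        {ω : BondConfig (Site d) | ∃ x ∈ X, ∃ t ∈ T,
          ω ∈ openConnIn ((↑W : Set (Site d)) \ ↑H) x t}) \
        ⋃ UR ∈ ((box d b).powerset.filter (fun U => box d a ⊆ U)) ×ˢ (box d (b + 1)).powerset,
          ({ω | ω ∩ (↑((box d (b + 1)).sym2) : Set (Sym2 (Site d))) ∈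
              explEvent (↑(box d a) : Set (Site d)) ((↑(box d b) : Set (Site d)) \ ↑(box d a)) ↑UR.1 ↑UR.2} ∩
            {ω | ∀ r ∈ UR.2, ∀ r' ∈ UR.2, ∃ v ∈ UR.1, ∃ v' ∈ UR.1,
              s(v, r) ∈ ω ∧ s(v', r') ∈ ω ∧ ω ∈ openConnIn ((↑UR.1 : Set (Site d)) \ ↑(box d (a - 1))) v v'})) ≤
      (bondPercolation (zdGraph d) p).real
        ({ω : BondConfig (Site d) | ∃ x ∈ X, ∃ t ∈ T,
            ω ∈ openConnIn ((↑W : Set (Site d)) \ ↑H) x t} ∩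
         {ω : BondConfig (Site d) | ∃ t₁ ∈ innerBoundary (zdGraph d) (box d a), ∃ w₁ ∈ innerBoundary (zdGraph d) (box d b),
            ∃ t₂ ∈ innerBoundary (zdGraph d) (box d a), ∃ w₂ ∈ innerBoundary (zdGraph d) (box d b),
            ω ∩ {e : Sym2 (Site d) | e ∈ (↑((box d b).sym2) : Set (Sym2 (Site d))) ∧
                ¬ (∀ v ∈ e, v ∈ box d a) ∧ ¬ (∀ v ∈ e, v ∈ innerBoundary (zdGraph d) (box d b))} ∈
              openConnIn (↑(box d b) : Set (Site d)) t₁ w₁ ∧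
            ω ∩ {e : Sym2 (Site d) | e ∈ (↑((box d b).sym2) : Set (Sym2 (Site d))) ∧
                ¬ (∀ v ∈ e, v ∈ box d a) ∧ ¬ (∀ v ∈ e, v ∈ innerBoundary (zdGraph d) (box d b))} ∈
              openConnIn (↑(box d b) : Set (Site d)) t₂ w₂ ∧
            ω ∩ {e : Sym2 (Site d) | e ∈ (↑((box d b).sym2) : Set (Sym2 (Site d))) ∧
                ¬ (∀ v ∈ e, v ∈ box d a) ∧ ¬ (∀ v ∈ e, v ∈ innerBoundary (zdGraph d) (box d b))} ∉
              openConnIn (↑(box d b) : Set (Site d)) w₁ w₂}) := by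
  classical
  have hab' : a ≤ b := by omega
  refine real_mono_of_forall_subset_edgeSet (zdGraph d) p fun ω hω h => ?_
  obtain ⟨⟨-, hC⟩, hG⟩ := h
  refine ⟨hC, ?_⟩
  by_contra hN
  apply hG
  -- the own datum of `ω`
  set In : Set (Site d) := ↑(box d a) with hIn
  set Blk : Set (Site d) := (↑(box d b) : Set (Site d)) \ ↑(box d a) with hBlk
  have hIB : In ∪ Blk = ↑(box d b) := coe_box_union_sdiff hab'
  set Uf : Finset (Site d) := (box d b).filter (fun x => x ∈ explSet In Blk ω) with hUf
  set Rf : Finset (Site d) := (box d (b + 1)).filter (fun x => x ∈ explRim In Blk ω) with hRf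
  have hUfb : Uf ⊆ box d b := Finset.filter_subset _ _
  have hRfb : Rf ⊆ box d (b + 1) := Finset.filter_subset _ _
  have hUf' : (↑Uf : Set (Site d)) = explSet In Blk ω := by
    ext x
    rw [hUf, Finset.coe_filter, Set.mem_setOf_eq]
    exact ⟨fun hx => hx.2, fun hx => ⟨Finset.mem_coe.1 (by rw [← hIB]; exact explSet_subset In Blk ω hx), hx⟩⟩
  have hRf' : (↑Rf : Set (Site d)) = explRim In Blk ω := by
    ext r
    rw [hRf, Finset.coe_filter, Set.mem_setOf_eq]
    refine ⟨fun hr => hr.2, fun hr => ⟨?_, hr⟩⟩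
    obtain ⟨-, v, hv, hvr⟩ := mem_explRim_iff.1 hr
    have hadj : (zdGraph d).Adj v r := by have := hω hvr; rwa [SimpleGraph.mem_edgeSet] at this
    exact mem_box_succ_of_adj_box hadj (Finset.mem_coe.1 (by rw [← hIB]; exact explSet_subset In Blk ω hv))
  have hUa : box d a ⊆ Uf := fun x hx =>
    Finset.mem_coe.1 (by rw [hUf']; exact subset_explSet In Blk ω (Finset.mem_coe.2 hx))
  have hmem : (Uf, Rf) ∈ ((box d b).powerset.filter (fun U => box d a ⊆ U)) ×ˢ (box d (b + 1)).powerset := by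
    rw [Finset.mem_product, Finset.mem_filter, Finset.mem_powerset, Finset.mem_powerset]
    exact ⟨⟨hUfb, hUa⟩, hRfb⟩
  have hDAT : ω ∩ (↑((box d (b + 1)).sym2) : Set (Sym2 (Site d))) ∈ explEvent In Blk ↑Uf ↑Rf := by
    rw [mem_dat_iff_mem_explEvent (a := a) hUfb hω, hUf', hRf']
    exact mem_explEvent_self In Blk ω
  have hLINK := link'_of_dat_of_not_nonuniq ha hab hUfb hω hDAT hN
  exact Set.mem_iUnion₂.2 ⟨(Uf, Rf), hmem, hDAT, hLINK⟩

/-- **The two-sided one-level decomposition, general aspect and general conditioning target** (Basu–Sapozhnikov (2.5)/(2.6) with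
hole and source, under (A2)□(ϰ; σ, τ); target `T ⊆ W ∖ Λ(τ m₂)`, region `W ⊇ Λ(τ m₂)`).
[cite: BasuSapozhnikov2017ECP, §2 eqs. (2.5)–(2.6)] -/
theorem sum_real_level_two_sided_target (p : unitInterval) {ϰ : ℝ} (hϰ : 0 < ϰ)
    {σ τ : ℕ → ℕ} (hσ : ∀ m : ℕ, 1 ≤ m → m < σ m) (hστ : ∀ m : ℕ, 1 ≤ m → σ m < τ m)
    (hA2 : ∀ m : ℕ, 1 ≤ m → ∀ Z : Finset (Site d), box d (τ m) \ box d (m - 1) ⊆ Z →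
      ∀ X : Finset (Site d), X ⊆ Z ∩ box d m → ∀ Y : Finset (Site d), Y ⊆ Z \ box d (τ m) →
        ϰ * (bondPercolation (zdGraph d) p).real {ω | ∃ x ∈ X, ∃ s ∈ innerBoundary (zdGraph d) (box d (σ m)),
              ω ∈ openConnIn (↑Z : Set (Site d)) x s} *
          (bondPercolation (zdGraph d) p).real {ω | ∃ y ∈ Y, ∃ s ∈ innerBoundary (zdGraph d) (box d (σ m)),
              ω ∈ openConnIn (↑Z : Set (Site d)) y s} ≤
        (bondPercolation (zdGraph d) p).real {ω | ∃ x ∈ X, ∃ y ∈ Y, ω ∈ openConnIn (↑Z : Set (Site d)) x y})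
    {m₁ m₂ : ℕ} (hm₁ : 1 ≤ m₁) (hm₁₂ : m₁ ≤ m₂) (h12 : τ m₁ < σ m₂) {W T : Finset (Site d)} (hW : box d (τ m₂) ⊆ W)
    (hTW : T ⊆ W) (hTb : ∀ t ∈ T, t ∉ box d (τ m₂))
    {H X : Finset (Site d)} (hH : H ⊆ box d (m₁ - 1)) (hX : X ⊆ box d m₁) (hXH : ∀ x ∈ X, x ∉ H)
    {E : Set (BondConfig (Site d))} {F : Finset (Sym2 (Site d))} (hE : DeterminedBy E ↑F) (hF : F ⊆ (box d (σ m₁)).sym2) :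
    (bondPercolation (zdGraph d) p).real (E ∩ {ω : BondConfig (Site d) | ∃ x ∈ X, ∃ t ∈ T,
          ω ∈ openConnIn ((↑W : Set (Site d)) \ ↑H) x t}) -
        ϰ⁻¹ ^ 2 * (bondPercolation (zdGraph d) p).real (boxCrossing d (σ m₁) (σ m₂)) *
          (bondPercolation (zdGraph d) p).real {ω : BondConfig (Site d) | ∃ x ∈ X, ∃ t ∈ T,
            ω ∈ openConnIn ((↑W : Set (Site d)) \ ↑H) x t} ≤
      ∑ UR ∈ ((box d (σ m₂)).powerset.filter (fun U => box d (σ m₁) ⊆ U)) ×ˢ (box d (σ m₂ + 1)).powerset,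
        (bondPercolation (zdGraph d) p).real (E ∩
          {ω | ω ∩ (↑((box d (σ m₂ + 1)).sym2) : Set (Sym2 (Site d))) ∈
            explEvent (↑(box d (σ m₁)) : Set (Site d)) ((↑(box d (σ m₂)) : Set (Site d)) \ ↑(box d (σ m₁))) ↑UR.1 ↑UR.2} ∩
          {ω | ∀ r ∈ UR.2, ∀ r' ∈ UR.2, ∃ v ∈ UR.1, ∃ v' ∈ UR.1,
            s(v, r) ∈ ω ∧ s(v', r') ∈ ω ∧ ω ∈ openConnIn ((↑UR.1 : Set (Site d)) \ ↑(box d (σ m₁ - 1))) v v'} ∩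
          {ω | ∃ x ∈ X, ∃ r ∈ UR.2, ∃ v ∈ UR.1, ω ∈ openConnIn ((↑UR.1 : Set (Site d)) \ ↑H) x v ∧ s(v, r) ∈ ω}) *
        (bondPercolation (zdGraph d) p).real {ω : BondConfig (Site d) | ∃ r ∈ UR.2, ∃ t ∈ T,
            ω ∈ openConnIn ((↑W : Set (Site d)) \ ↑UR.1) r t} ∧
    ∑ UR ∈ ((box d (σ m₂)).powerset.filter (fun U => box d (σ m₁) ⊆ U)) ×ˢ (box d (σ m₂ + 1)).powerset,
        (bondPercolation (zdGraph d) p).real (E ∩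
          {ω | ω ∩ (↑((box d (σ m₂ + 1)).sym2) : Set (Sym2 (Site d))) ∈
            explEvent (↑(box d (σ m₁)) : Set (Site d)) ((↑(box d (σ m₂)) : Set (Site d)) \ ↑(box d (σ m₁))) ↑UR.1 ↑UR.2} ∩
          {ω | ∀ r ∈ UR.2, ∀ r' ∈ UR.2, ∃ v ∈ UR.1, ∃ v' ∈ UR.1,
            s(v, r) ∈ ω ∧ s(v', r') ∈ ω ∧ ω ∈ openConnIn ((↑UR.1 : Set (Site d)) \ ↑(box d (σ m₁ - 1))) v v'} ∩
          {ω | ∃ x ∈ X, ∃ r ∈ UR.2, ∃ v ∈ UR.1, ω ∈ openConnIn ((↑UR.1 : Set (Site d)) \ ↑H) x v ∧ s(v, r) ∈ ω}) *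
        (bondPercolation (zdGraph d) p).real {ω : BondConfig (Site d) | ∃ r ∈ UR.2, ∃ t ∈ T,
            ω ∈ openConnIn ((↑W : Set (Site d)) \ ↑UR.1) r t} ≤
      (bondPercolation (zdGraph d) p).real (E ∩ {ω : BondConfig (Site d) | ∃ x ∈ X, ∃ t ∈ T,
          ω ∈ openConnIn ((↑W : Set (Site d)) \ ↑H) x t}) := by
  classical
  have hσ1 := hσ m₁ hm₁
  have hστ1 := hστ m₁ hm₁
  have hσ2 := hσ m₂ (by omega)
  have hστ2 := hστ m₂ (by omega)
  set μ := bondPercolation (zdGraph d) p with hμ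
  set a := σ m₁ with ha
  set b := σ m₂ with hb
  have ha1 : 1 ≤ a := by omega
  have hab : a ≤ b := by omega
  have hab1 : a ≤ b - 1 := by omega
  have hbW : box d (b + 1) ⊆ W := (box_mono d (by omega)).trans hW
  have hTb' : ∀ t ∈ T, t ∉ box d (b + 1) := fun t ht h => hTb t ht (box_mono d (by omega) h)
  have hHa : H ⊆ box d (a - 1) := hH.trans (box_mono d (by omega))
  have hXa : X ⊆ box d a := hX.trans (box_mono d (by omega))
  set CONN := {ω : BondConfig (Site d) | ∃ x ∈ X, ∃ t ∈ T,
    ω ∈ openConnIn ((↑W : Set (Site d)) \ ↑H) x t} with hCONN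
  set 𝒟 := ((box d b).powerset.filter (fun U => box d a ⊆ U)) ×ˢ (box d (b + 1)).powerset with h𝒟
  set GOOD := ⋃ UR ∈ 𝒟, ({ω : BondConfig (Site d) | ω ∩ (↑((box d (b + 1)).sym2) : Set (Sym2 (Site d))) ∈
      explEvent (↑(box d a) : Set (Site d)) ((↑(box d b) : Set (Site d)) \ ↑(box d a)) ↑UR.1 ↑UR.2} ∩
    {ω | ∀ r ∈ UR.2, ∀ r' ∈ UR.2, ∃ v ∈ UR.1, ∃ v' ∈ UR.1,
      s(v, r) ∈ ω ∧ s(v', r') ∈ ω ∧ ω ∈ openConnIn ((↑UR.1 : Set (Site d)) \ ↑(box d (a - 1))) v v'}) with hGOOD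
  have hsum := sum_real_level_eq_target p hab hbW hTb' hHa hXa hE hF
  -- `hsum : Σ = μ.real (E ∩ CONN ∩ GOOD)`
  have hjunk := real_conn_inter_nonuniq_le_of_setToSetQM_target (d := d) p hϰ.le hσ hστ hA2 hm₁ hm₁₂ h12 hW hTW hTb hH hX hXH
  have hdiff := real_inter_conn_diff_good_le_target (d := d) p ha1 hab1 W T H X E
  have hϰ2 : 0 < ϰ ^ 2 := by positivity
  have hNU : μ.real ((E ∩ CONN) \ GOOD) ≤ ϰ⁻¹ ^ 2 * μ.real (boxCrossing d a b) * μ.real CONN := by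
    refine hdiff.trans ?_
    rw [inv_pow, mul_assoc]
    exact (le_inv_mul_iff₀ hϰ2).2 hjunk
  constructor
  · rw [hsum]
    have hsplit : μ.real (E ∩ CONN) ≤ μ.real (E ∩ CONN ∩ GOOD) + μ.real ((E ∩ CONN) \ GOOD) := by
      calc μ.real (E ∩ CONN) = μ.real ((E ∩ CONN ∩ GOOD) ∪ ((E ∩ CONN) \ GOOD)) := by rw [Set.inter_union_sdiff]
        _ ≤ _ := measureReal_union_le _ _
    linarith
  · rw [hsum]
    exact measureReal_mono (fun ω h => h.1) (measure_ne_top _ _)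

end Summit.CriticalPhenomena.PercolationContinuityZ3.Theorems.Crossing

end
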